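import Literature.Probability.Percolation.FourFunctionsProdBernoulli
import HarnessLib

/-!
# KN Question 8 at three relays — the centring atom (T*): its PV-part and its PM-part SEPARATELY, by Ahlswede–Daykin

Support file (`--supports stmt-CriticalPhenomena-4575`, closed crux; independent mathematics on Kozma–Nitzan's Question 8
at `|A| = 3`), prover `prim-hp-7` (gen 44).  No definitions, no named facts, no sorries; standard axioms.
Memo `run/shared/lean/prim/prim-hp-7/FROM-prim-hp-7-g44-JBERN.md` §0 and (R10).

Setting (memos prim-ineq-gen-7/FINDING-TSTAR-g12 §0, prim-hp-7/FROM-prim-hp-7-g40-TAN-MONOTONE §0).  Bond percolation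
`μ = prodBernoulli w` on a finite vertex type, owner `x`, observer `o`, marker `v`; atoms
`O = {o ↔ x}`, `O2 = {o ↔ x} ∪ {o ↔ v}`, `P = {o ↮ x} ∩ {o ↮ v}` ("pocket"), `PV = P ∩ {x ↔ v}`, `PM = P ∩ {x ↮ v}`,
masses `a = μ(O)`, `μ(O2) = a + e`, `π = μ(P)`, `f = μ(PV)`, `π_M = μ(PM)`.  For an increasing event `A` (in the memos:
`A = {U ∈ 𝒰}` for an up-set `𝒰` of vertex sets, `U = V(C_x ∪ C_o)`; here ANY increasing event of the configuration) the
centring atom of KN Q8@3 in its Strassen form (memo §0) is the three-law domination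
  (T*)   `μ(A | O) ≥ θ·μ(A | PV) + (1 − θ)·μ(A | PM)`,   `θ = μ(O2) μ(PV) / (μ(O) μ(P)) ∈ [0,1]`,
(open for the union / pair classes; false for general increasing `A`).  This file proves its two "parts" separately, each for
EVERY increasing event `A`, as four-events instances of the Ahlswede–Daykin theorem for the log-modular product measure
(tree: `Literature.Probability.Percolation.prodBernoulli_fourEvents`, Bollobás–Riordan Ch. 2 Thm. 7):

* `TstarAD.pvPart` :  `μ(O2) · μ(A ∩ PV) ≤ μ(P) · μ(A ∩ O)`   — i.e. `θ · μ(A | PV) ≤ μ(A | O)`  (the PV-part of (T*) ALONE).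
  Pointwise: `a ∈ O2`, `b ∈ A ∩ PV` ⟹ `a ∩ b ∈ P` (fewer edges than `b`) and `a ∪ b ∈ A ∩ O` (`o ↔ x` in `a`, or `o ↔ v` in `a`
  and `v ↔ x` in `b`).
* `TstarAD.pmPart` :  `μ(O) · μ(A ∩ PM) ≤ μ(PM) · μ(A ∩ O)`   — i.e. `μ(A | PM) ≤ μ(A | O)`.
* `TstarAD.pPart`  :  `μ(O) · μ(A ∩ P) ≤ μ(P) · μ(A ∩ O)`     — i.e. `μ(A | P) ≤ μ(A | O)` (Harris, recorded in the same form).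
* `TstarAD.mix_le_two_sub_theta` : the bookkeeping `θ γ_PV ≤ γ_O`, `γ_PM ≤ γ_O`, `0 ≤ θ ≤ 1` ⟹
  `θ γ_PV + (1−θ) γ_PM ≤ (2 − θ) γ_O`:  (T*) holds for every increasing event up to the factor `2 − θ` (sharp constant `1` is the
  open union-class statement; memo (R10) gives the slightly better factor `1 + e·c_M/(a(a+e))` in the `(1−λ)P + λ PV` form).
[cite: KozmaNitzan2024, Question 8 (§5.5 p. 36)] [cite: BollobasRiordan2006, Ch. 2 Thm. 7 and eq. (14)] [cite: AhlswedeDaykin1978, Theorem 1]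
-/

noncomputable section

namespace Summit.CriticalPhenomena.PercolationContinuityZ3.Theorems

namespace TstarAD

open MeasureTheory Set Literature.Probability.Percolation
open Literature.Probability.LatticeModels (prodBernoulli)

variable {V : Type*} [Fintype V]

omit [Fintype V] in
/-- Membership in the connection event `openConn u z` is reachability in the open graph (definitional). [folklore] -/
private theorem mem_openConn_iff (ω : BondConfig V) (u z : V) :
    ω ∈ (openConn u z : Set (BondConfig V)) ↔ (openGraph ω).Reachable u z := Iff.rfl

/-- **PV-part of (T*) by Ahlswede–Daykin.**  For every increasing event `A` of bond percolation `μ = prodBernoulli w` on a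
finite vertex type and vertices `x, o, v`:
`μ({o↔x} ∪ {o↔v}) · μ(A ∩ {o↮x} ∩ {o↮v} ∩ {x↔v}) ≤ μ({o↮x} ∩ {o↮v}) · μ(A ∩ {o↔x})`,
i.e. `θ · μ(A | PV) ≤ μ(A | O)` with `θ = μ(O2)μ(PV)/(μ(O)μ(P))` — the PV-part of the KN-Q8@3 centring atom (T*), alone.
[cite: BollobasRiordan2006, Ch. 2 Thm. 7 and eq. (14) — four-events corollary, derived here] [cite: KozmaNitzan2024, Question 8 (§5.5 p. 36)] -/
theorem pvPart (w : Sym2 V → unitInterval) (x o v : V) (A : Set (BondConfig V)) (hA : IsUpperSet A) :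
    (prodBernoulli w).real (openConn o x ∪ openConn o v) *
        (prodBernoulli w).real (A ∩ ((openConn o x)ᶜ ∩ (openConn o v)ᶜ ∩ openConn x v)) ≤
      (prodBernoulli w).real ((openConn o x)ᶜ ∩ (openConn o v)ᶜ) *
        (prodBernoulli w).real (A ∩ openConn o x) := by
  refine prodBernoulli_fourEvents w _ _ _ _ fun a ha b hb => ?_
  have openGraph_le : ∀ {ω ω' : BondConfig V}, ω ⊆ ω' → openGraph ω ≤ openGraph ω' :=
    fun h => BHK2006.openGraph_le h
  simp only [mem_inter_iff, mem_union, mem_compl_iff, mem_openConn_iff] at ha hb ⊢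
  obtain ⟨hbA, ⟨hox, hov⟩, hxv⟩ := hb
  have hlb : openGraph (a ∩ b) ≤ openGraph b := openGraph_le inter_subset_right
  have hua : openGraph a ≤ openGraph (a ∪ b) := openGraph_le subset_union_left
  have hub : openGraph b ≤ openGraph (a ∪ b) := openGraph_le subset_union_right
  refine ⟨⟨fun h => hox (h.mono hlb), fun h => hov (h.mono hlb)⟩, hA (subset_union_right : b ⊆ a ∪ b) hbA, ?_⟩
  rcases ha with h | h
  · exact h.mono hua
  · exact (h.mono hua).trans (hxv.mono hub).symm

/-- **PM-part of (T*) by Ahlswede–Daykin.**  For every increasing event `A`: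
`μ({o↔x}) · μ(A ∩ {o↮x} ∩ {o↮v} ∩ {x↮v}) ≤ μ({o↮x} ∩ {o↮v} ∩ {x↮v}) · μ(A ∩ {o↔x})`, i.e. `μ(A | PM) ≤ μ(A | O)`.
[cite: BollobasRiordan2006, Ch. 2 Thm. 7 and eq. (14) — four-events corollary, derived here] [cite: KozmaNitzan2024, Question 8 (§5.5 p. 36)] -/
theorem pmPart (w : Sym2 V → unitInterval) (x o v : V) (A : Set (BondConfig V)) (hA : IsUpperSet A) :
    (prodBernoulli w).real (openConn o x) *
        (prodBernoulli w).real (A ∩ ((openConn o x)ᶜ ∩ (openConn o v)ᶜ ∩ (openConn x v)ᶜ)) ≤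
      (prodBernoulli w).real ((openConn o x)ᶜ ∩ (openConn o v)ᶜ ∩ (openConn x v)ᶜ) *
        (prodBernoulli w).real (A ∩ openConn o x) := by
  refine prodBernoulli_fourEvents w _ _ _ _ fun a ha b hb => ?_
  have openGraph_le : ∀ {ω ω' : BondConfig V}, ω ⊆ ω' → openGraph ω ≤ openGraph ω' :=
    fun h => BHK2006.openGraph_le h
  simp only [mem_inter_iff, mem_compl_iff, mem_openConn_iff] at ha hb ⊢
  obtain ⟨hbA, ⟨hox, hov⟩, hxv⟩ := hb
  have hlb : openGraph (a ∩ b) ≤ openGraph b := openGraph_le inter_subset_right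
  have hua : openGraph a ≤ openGraph (a ∪ b) := openGraph_le subset_union_left
  exact ⟨⟨⟨fun h => hox (h.mono hlb), fun h => hov (h.mono hlb)⟩, fun h => hxv (h.mono hlb)⟩,
    hA (subset_union_right : b ⊆ a ∪ b) hbA, ha.mono hua⟩

/-- **P-part (Harris in four-events form).**  For every increasing event `A`:
`μ({o↔x}) · μ(A ∩ {o↮x} ∩ {o↮v}) ≤ μ({o↮x} ∩ {o↮v}) · μ(A ∩ {o↔x})`, i.e. `μ(A | P) ≤ μ(A | O)`.
[cite: BollobasRiordan2006, Ch. 2 Thm. 7 and eq. (14) — four-events corollary, derived here] [cite: KozmaNitzan2024, Question 8 (§5.5 p. 36)] -/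
theorem pPart (w : Sym2 V → unitInterval) (x o v : V) (A : Set (BondConfig V)) (hA : IsUpperSet A) :
    (prodBernoulli w).real (openConn o x) *
        (prodBernoulli w).real (A ∩ ((openConn o x)ᶜ ∩ (openConn o v)ᶜ)) ≤
      (prodBernoulli w).real ((openConn o x)ᶜ ∩ (openConn o v)ᶜ) *
        (prodBernoulli w).real (A ∩ openConn o x) := by
  refine prodBernoulli_fourEvents w _ _ _ _ fun a ha b hb => ?_
  have openGraph_le : ∀ {ω ω' : BondConfig V}, ω ⊆ ω' → openGraph ω ≤ openGraph ω' :=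
    fun h => BHK2006.openGraph_le h
  simp only [mem_inter_iff, mem_compl_iff, mem_openConn_iff] at ha hb ⊢
  obtain ⟨hbA, hox, hov⟩ := hb
  have hlb : openGraph (a ∩ b) ≤ openGraph b := openGraph_le inter_subset_right
  have hua : openGraph a ≤ openGraph (a ∪ b) := openGraph_le subset_union_left
  exact ⟨⟨fun h => hox (h.mono hlb), fun h => hov (h.mono hlb)⟩,
    hA (subset_union_right : b ⊆ a ∪ b) hbA, ha.mono hua⟩

/-- **(T*) within the factor `2 − θ`** (bookkeeping): if `θ γ_PV ≤ γ_O` (`pvPart`, normalised), `γ_PM ≤ γ_O` (`pmPart`,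
normalised) and `0 ≤ θ ≤ 1`, then `θ γ_PV + (1 − θ) γ_PM ≤ (2 − θ) γ_O`; the open centring atom (T*) is the constant `1`.
[cite: KozmaNitzan2024, Question 8 (§5.5 p. 36)] -/
theorem mix_le_two_sub_theta (θ γO γPV γPM : ℝ) (hθ₁ : θ ≤ 1) (hPV : θ * γPV ≤ γO) (hPM : γPM ≤ γO) :
    θ * γPV + (1 - θ) * γPM ≤ (2 - θ) * γO := by
  nlinarith [mul_le_mul_of_nonneg_left hPM (sub_nonneg.2 hθ₁)]

end TstarAD

end Summit.CriticalPhenomena.PercolationContinuityZ3.Theorems
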